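import Summits.QuantumFields.YangMills.Theses.LangevinControlUV
import Summits.QuantumFields.YangMills.Theorems.LangevinControlUVLatticeGapInUVUnitsCStubSeed

/-!
# Crux `LatticeGapInUVUnitsC` (stmt-QuantumFields-16206): reduction to an a-FREE finite-size certificate

Support file for item stmt-QuantumFields-16206 (route `LangevinControlUV` of `YangMills`), line lead
prover-line-stmt-QuantumFields-16206-c4-0 (2026-08-17), line `nested-shell-rho-mixing`, skeleton v6
(`Cruxes/LatticeGapInUVUnitsC/Lines/nested_shell_rho_mixing.lean`, namespace `…Cruxes.LatticeGapInUVUnitsC.AmplitudeCriterion`).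

The crux (femto two-point package in CONTINUOUS units ⇒ volume-uniform clustering of all gauge-invariant local observables
at rate `c₁ a(β)`) is reduced here, kernel-checked and DEF-FREE, to ONE certificate that mentions NO unit map `a`, NO shape
function `Γ` and NO continuity — the finite-size criterion the item's informal text names ("amplitude ≥ u_min at lattice
scale n(β) ⇒ clustering at rate ≥ c₁′/n(β) — an a-free implication"):

* certificate (stub S6 `stub_fsCertificate`, OPEN — the weak-coupling volume-uniform mass gap in finite-size-scaling
  clothing): for every `u > 0` there are `κ > 0`, `β₂`, `K` and per-pair constants `C(A,B)` such that for all `β ≥ β₂`,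
  `N ≥ 1`: if the dimensionless top-of-box curvature amplitude `N⁸ · Cov_{β,(ℤ/8N)⁴}(P_0^{01}, P_{N e₂}^{01})` is `≥ u`, then
  `|corr_β^{(2S+1)}(A, B; t)| ≤ C e^{−κ t / N}` on every torus `S ≥ K N`, `t ≤ S`;
* seed (LANDED, `AmplitudeRatchet.stub_seed`, p122527): for a continuous unit map `a` carrying the package the amplitude
  is `≥ umin > 0` on the top femto octave `ℓ₀ ≤ 16 N a(β)`, `8 N a(β) ≤ ℓ₀`, `β ≥ β₀` (interval pinning of `Γ` —
  the one place where `Continuous a` and the SIZE `c > 0` of the package's lower bound do infrared work);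
* transfer (stub S7 `stub_fsTransfer`, THIS FILE): `a → 0` places `N(β) = ⌈ℓ₀/(16 a β)⌉₊` in the octave once
  `a β < ℓ₀/16`; the certificate at `u = umin` fires at `(β, N(β))`; `8 N(β) a(β) ≤ ℓ₀` gives
  `κ t / N(β) ≥ (8κ/ℓ₀) a(β) t`, so `c₁ = 8κ/ℓ₀`, `S₁ β = K N(β)`, constants `max C 0`.

All three load-bearing hypotheses of the standing Disproof (`Cruxes/LatticeGapInUVUnitsC/Disproof.lean` §2) are consumed:
continuity and the lower bound's size by the seed, `a → 0` by the transfer; the certificate is asked only at pairs `(β, N)`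
actually certified by the package (no "for all continuous rulers" shape, cf. `not_forall_continuous_concl_of_xiUnbounded`).
`latticeGapInUVUnitsC_of_fsCertificate` is the def-free one-hypothesis form (certificate ⇒ crux BY NAME).

References: M. Lüscher, P. Weisz, U. Wolff, *A numerical method to compute the running coupling in asymptotically free
theories*, Nucl. Phys. B 359 (1991) 221 (finite-size scaling in units of the box); A. Jaffe, E. Witten, *Quantum
Yang–Mills theory* (2000), §6.
-/

open scoped BigOperators
open MeasureTheory Filter Topology
open Literature.MathematicalPhysics.QuantumFieldTheory Literature.MathematicalPhysics.QuantumLattice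
open Summit.QuantumFields.YangMills.Theses.LangevinControlUV

noncomputable section

namespace Summit.QuantumFields.YangMills.Theorems.LatticeGapInUVUnitsC.AmplitudeCriterion

section Pipeline

variable {G : Type} [Group G] [TopologicalSpace G] [IsTopologicalGroup G] [CompactSpace G]
  [MeasurableSpace G] [BorelSpace G]

/-- **Seed + a-free certificate + `a → 0` ⇒ clustering in the units of `a`.**  If the top-of-box amplitude is `≥ umin`
on the top femto octave (`ℓ₀ ≤ 16 N a β`, `8 N a β ≤ ℓ₀`, `β ≥ β₀`) and the finite-size certificate holds at threshold
`umin` (rate `κ/N` on tori `S ≥ K N` whenever the amplitude at `(β, N)`, `β ≥ β₂`, `N ≥ 1`, is `≥ umin`), then all pairs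
of gauge-invariant local observables cluster at rate `(8κ/ℓ₀) a(β)` on every torus `S ≥ K ⌈ℓ₀/(16 a β)⌉₊`, `t ≤ S`, for
`β ≥ max (max β₀ β₂) β₄` (`a β < ℓ₀/16` beyond `β₄`), with per-pair constants `max C 0`. -/
theorem concl_of_fsCertificate (r : LatticeRep G) {a : ℝ → ℝ} (hpos : ∀ β, 0 < a β)
    (hlim : Tendsto a atTop (𝓝 0)) {β₀ ℓ₀ umin κ β₂ : ℝ} {K : ℕ} (hℓ₀ : 0 < ℓ₀) (hκ : 0 < κ)
    (hseed : ∀ β : ℝ, β₀ ≤ β → ∀ (N : ℕ) [NeZero (8 * N)], ℓ₀ ≤ 16 * ((N : ℝ) * a β) → 8 * ((N : ℝ) * a β) ≤ ℓ₀ → umin ≤ ((N : ℕ) : ℝ) ^ 8 * (wilsonExpectation r.ρ β (fun U : GaugeConfig 4 (8 * N) G => ((r.N : ℝ) - (r.ρ (plaquetteHolonomy U 0 0 1)).trace.re) * ((r.N : ℝ) - (r.ρ (plaquetteHolonomy U (Pi.single (2 : Fin 4) ((N : ℕ) : ZMod (8 * N))) 0 1)).trace.re)) - wilsonExpectation r.ρ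 β (fun U : GaugeConfig 4 (8 * N) G => (r.N : ℝ) - (r.ρ (plaquetteHolonomy U 0 0 1)).trace.re) * wilsonExpectation r.ρ β (fun U : GaugeConfig 4 (8 * N) G => (r.N : ℝ) - (r.ρ (plaquetteHolonomy U (Pi.single (2 : Fin 4) ((N : ℕ) : ZMod (8 * N))) 0 1)).trace.re)))
    (hcert : ∀ A B : YMSpecies G, ∃ C : ℝ, ∀ β : ℝ, β₂ ≤ β → ∀ (N : ℕ) [NeZero (8 * N)], 1 ≤ N → umin ≤ ((N : ℕ) : ℝ) ^ 8 * (wilsonExpectation r.ρ β (fun U : GaugeConfig 4 (8 * N) G => ((r.N : ℝ) - (r.ρ (plaquetteHolonomy U 0 0 1)).trace.re) * ((r.N : ℝ) - (r.ρ (plaquetteHolonomy U (Pi.single (2 : Fin 4) ((N : ℕ) : ZMod (8 * N))) 0 1)).trace.re)) - wilsonExpectation r.ρ β (fun U : GaugeConfig 4 (8 * N) G => (r.N : ℝ) - (r.ρ (plaquetteHolonomy U 0 0 1)).trace.re) * wilsonExpectation r.ρ β (fun U : GaugeConfig 4 (8 * N) G => (r.N : ℝ) - (r.ρ (plaquetteHolonomy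 U (Pi.single (2 : Fin 4) ((N : ℕ) : ZMod (8 * N))) 0 1)).trace.re)) → ∀ S t : ℕ, K * N ≤ S → t ≤ S → |latticeConnectedCorr r.ρ β (2 * S + 1) A.F B.F t| ≤ C * Real.exp (-(κ * t / N))) :
    ∃ (c₁ β₃ : ℝ) (S₁ : ℝ → ℕ), 0 < c₁ ∧ ∀ A B : YMSpecies G, ∃ C : ℝ, ∀ β : ℝ, β₃ ≤ β → ∀ S t : ℕ, S₁ β ≤ S → t ≤ S → |latticeConnectedCorr r.ρ β (2 * S + 1) A.F B.F t| ≤ C * Real.exp (-(c₁ * a β * t)) := by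
  -- `a β < ℓ₀ / 16` eventually
  have h16 : (0 : ℝ) < ℓ₀ / 16 := by positivity
  obtain ⟨β₄, hβ₄⟩ := eventually_atTop.1 (hlim (Iio_mem_nhds h16))
  refine ⟨8 * κ / ℓ₀, max (max β₀ β₂) β₄, fun β => K * ⌈ℓ₀ / (16 * a β)⌉₊, by positivity, fun A B => ?_⟩
  obtain ⟨C, hC⟩ := hcert A B
  refine ⟨max C 0, fun β hβ S t hS ht => ?_⟩
  have hβ₀ : β₀ ≤ β := ((le_max_left _ _).trans (le_max_left _ _)).trans hβ
  have hβ₂ : β₂ ≤ β := ((le_max_right _ _).trans (le_max_left _ _)).trans hβ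
  have haℓ : a β < ℓ₀ / 16 := hβ₄ β ((le_max_right _ _).trans hβ)
  have ha := hpos β
  have hS' : K * ⌈ℓ₀ / (16 * a β)⌉₊ ≤ S := hS
  -- the scale `N(β) = ⌈ℓ₀ / (16 a β)⌉₊` lies in the seed's octave
  set N : ℕ := ⌈ℓ₀ / (16 * a β)⌉₊ with hNdef
  have hq : 0 < ℓ₀ / (16 * a β) := by positivity
  have hN1 : 1 ≤ N := Nat.one_le_iff_ne_zero.2 (Nat.ceil_pos.2 hq).ne'
  haveI : NeZero (8 * N) := ⟨by omega⟩
  have hNge : ℓ₀ / (16 * a β) ≤ (N : ℝ) := Nat.le_ceil _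
  have hNlt : (N : ℝ) < ℓ₀ / (16 * a β) + 1 := Nat.ceil_lt_add_one hq.le
  have hwin1 : ℓ₀ ≤ 16 * ((N : ℝ) * a β) := by
    have h1 : ℓ₀ / (16 * a β) * (16 * a β) = ℓ₀ := div_mul_cancel₀ ℓ₀ (by positivity)
    nlinarith
  have hwin2 : 8 * ((N : ℝ) * a β) ≤ ℓ₀ := by
    have h1 : (ℓ₀ / (16 * a β) + 1) * (16 * a β) = ℓ₀ + 16 * a β := by
      rw [add_mul, one_mul, div_mul_cancel₀ ℓ₀ (by positivity)]
    nlinarith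
  -- the seed: amplitude `≥ umin` at `(β, N)`; the certificate fires
  have hamp := hseed β hβ₀ N hwin1 hwin2
  have hclust := hC β hβ₂ N hN1 hamp S t hS' ht
  -- rate comparison: `(8κ/ℓ₀) a β t ≤ κ t / N` from `8 N a β ≤ ℓ₀`
  have hNpos : (0 : ℝ) < (N : ℝ) := by exact_mod_cast hN1
  have ht0 : (0 : ℝ) ≤ t := Nat.cast_nonneg t
  have hrate : 8 * κ / ℓ₀ * a β ≤ κ / (N : ℝ) := by
    rw [div_mul_eq_mul_div, div_le_div_iff₀ hℓ₀ hNpos]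
    calc 8 * κ * a β * (N : ℝ) = κ * (8 * ((N : ℝ) * a β)) := by ring
      _ ≤ κ * ℓ₀ := mul_le_mul_of_nonneg_left hwin2 hκ.le
  have key : 8 * κ / ℓ₀ * a β * t ≤ κ * t / (N : ℝ) :=
    calc 8 * κ / ℓ₀ * a β * t ≤ κ / (N : ℝ) * t := mul_le_mul_of_nonneg_right hrate ht0
      _ = κ * t / (N : ℝ) := by ring
  calc |latticeConnectedCorr r.ρ β (2 * S + 1) A.F B.F t| ≤ C * Real.exp (-(κ * t / N)) := hclust
    _ ≤ max C 0 * Real.exp (-(κ * t / N)) :=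
        mul_le_mul_of_nonneg_right (le_max_left _ _) (Real.exp_pos _).le
    _ ≤ max C 0 * Real.exp (-(8 * κ / ℓ₀ * a β * t)) :=
        mul_le_mul_of_nonneg_left (Real.exp_le_exp.2 (neg_le_neg key)) (le_max_right _ _)

end Pipeline

/-- **S7 `stub_fsTransfer` of the registered skeleton v6** (`Cruxes/LatticeGapInUVUnitsC/Lines/nested_shell_rho_mixing.lean`,
namespace `…Cruxes.LatticeGapInUVUnitsC.AmplitudeCriterion`), registered signature verbatim: the seed's octave bound, the
a-free certificate at threshold `umin`, `a > 0` and `a → 0` give the crux's conclusion (per-pair constants, rate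
`(8κ/ℓ₀) a β`).  Proof: `concl_of_fsCertificate`. -/
theorem stub_fsTransfer : ∀ (G : Type) [Group G] [TopologicalSpace G] [IsTopologicalGroup G] [CompactSpace G] [MeasurableSpace G] [BorelSpace G] (r : LatticeRep G) (a : ℝ → ℝ) (β₀ ℓ₀ umin κ β₂ : ℝ) (K : ℕ), (∀ β, 0 < a β) → Filter.Tendsto a Filter.atTop (nhds 0) → 0 < ℓ₀ → 0 < κ → (∀ β : ℝ, β₀ ≤ β → ∀ (N : ℕ) [NeZero (8 * N)], ℓ₀ ≤ 16 * ((N : ℝ) * a β) → 8 * ((N : ℝ) * a β) ≤ ℓ₀ → umin ≤ ((N : ℕ) : ℝ) ^ 8 * (wilsonExpectation r.ρ β (fun U : GaugeConfig 4 (8 * N) G => ((r.N : ℝ) - (r.ρ (plaquetteHolonomy U 0 0 1)).trace.re) * ((r.N : ℝ) - (r.ρ (plaquetteHolonomy U (Pi.single (2 : Fin 4) ((N : ℕ) : ZMod (8 * N))) 0 1)).trace.re)) - wilsonExpectation r.ρ β (fun U : GaugeConfig 4 (8 * N) G => (r.N : ℝ) - (r.ρ (plaquetteHolonomy U 0 0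 1)).trace.re) * wilsonExpectation r.ρ β (fun U : GaugeConfig 4 (8 * N) G => (r.N : ℝ) - (r.ρ (plaquetteHolonomy U (Pi.single (2 : Fin 4) ((N : ℕ) : ZMod (8 * N))) 0 1)).trace.re))) → (∀ A B : YMSpecies G, ∃ C : ℝ, ∀ β : ℝ, β₂ ≤ β → ∀ (N : ℕ) [NeZero (8 * N)], 1 ≤ N → umin ≤ ((N : ℕ) : ℝ) ^ 8 * (wilsonExpectation r.ρ β (fun U : GaugeConfig 4 (8 * N) G => ((r.N : ℝ) - (r.ρ (plaquetteHolonomy U 0 0 1)).trace.re) * ((r.N : ℝ) - (r.ρ (plaquetteHolonomy U (Pi.single (2 : Fin 4) ((N : ℕ) : ZMod (8 * N))) 0 1)).trace.re)) - wilsonExpectation r.ρ β (fun U : GaugeConfig 4 (8 * N) G => (r.N : ℝ) - (r.ρ (plaquetteHolonomy U 0 0 1)).trace.re) * wilsonExpectation r.ρ β (fun U : GaugeConfig 4 (8 * N) G => (r.N : ℝ) - (r.ρ (plaquetteHolonomy U (Pi.single (2 : Fin 4) ((N : ℕ) : ZMod (8 * N))) 0 1)).trace.re)) → ∀ S t : ℕ,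 K * N ≤ S → t ≤ S → |latticeConnectedCorr r.ρ β (2 * S + 1) A.F B.F t| ≤ C * Real.exp (-(κ * t / N))) → ∃ (c₁ β₃ : ℝ) (S₁ : ℝ → ℕ), 0 < c₁ ∧ ∀ A B : YMSpecies G, ∃ C : ℝ, ∀ β : ℝ, β₃ ≤ β → ∀ S t : ℕ, S₁ β ≤ S → t ≤ S → |latticeConnectedCorr r.ρ β (2 * S + 1) A.F B.F t| ≤ C * Real.exp (-(c₁ * a β * t)) := by
  intro G _ _ _ _ _ _ r a β₀ ℓ₀ umin κ β₂ K hpos hlim hℓ₀ hκ hseed hcert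
  exact concl_of_fsCertificate r hpos hlim hℓ₀ hκ hseed hcert

/-- **The crux from ONE a-free finite-size certificate, def-free**: if for every compact simple `G`, faithful `r` and
threshold `u > 0` the top-of-box curvature amplitude `N⁸ · Cov_{β,(ℤ/8N)⁴}(P_0^{01}, P_{N e₂}^{01}) ≥ u` at `β ≥ β₂`, `N ≥ 1`
forces clustering of all species pairs at rate `κ(u)/N` on all tori `S ≥ K(u) N` (per-pair constants), then
`LatticeGapInUVUnitsC` holds BY NAME — through the landed seed `AmplitudeRatchet.stub_seed` (p122527) and
`concl_of_fsCertificate`. -/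
theorem latticeGapInUVUnitsC_of_fsCertificate (hCert : ∀ (G : Type) [Group G] [TopologicalSpace G] [IsTopologicalGroup G] [CompactSpace G] [MeasurableSpace G] [BorelSpace G], IsCompactSimpleLieGroup G → ∀ (r : LatticeRep G) (u : ℝ), 0 < u → ∃ (κ β₂ : ℝ) (K : ℕ), 0 < κ ∧ ∀ A B : YMSpecies G, ∃ C : ℝ, ∀ β : ℝ, β₂ ≤ β → ∀ (N : ℕ) [NeZero (8 * N)], 1 ≤ N → u ≤ ((N : ℕ) : ℝ) ^ 8 * (wilsonExpectation r.ρ β (fun U : GaugeConfig 4 (8 * N) G => ((r.N : ℝ) - (r.ρ (plaquetteHolonomy U 0 0 1)).trace.re) * ((r.N : ℝ) - (r.ρ (plaquetteHolonomy U (Pi.single (2 : Fin 4) ((N : ℕ) : ZMod (8 * N))) 0 1)).trace.re)) - wilsonExpectation r.ρ β (fun U : GaugeConfig 4 (8 * N) G => (r.N : ℝ) - (r.ρ (plaquetteHolonomy U 0 0 1)).trace.re) * wilsonExpectation r.ρ β (fun U : GaugeConfig 4 (8 * N) G => (r.N : ℝ) - (r.ρ (plaquetteHolonomy U (Pi.single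 (2 : Fin 4) ((N : ℕ) : ZMod (8 * N))) 0 1)).trace.re)) → ∀ S t : ℕ, K * N ≤ S → t ≤ S → |latticeConnectedCorr r.ρ β (2 * S + 1) A.F B.F t| ≤ C * Real.exp (-(κ * t / N))) : LatticeGapInUVUnitsC := by
  intro G _ _ _ _ hG
  letI : MeasurableSpace G := borel G
  haveI : BorelSpace G := ⟨rfl⟩
  intro r a ha hP
  obtain ⟨Γ, β₀, ℓ₀, c, C, hℓ₀, hc, hpos, hlim, hΓ, hbox⟩ := hP
  obtain ⟨umin, humin, hseed⟩ :=
    Summit.QuantumFields.YangMills.Theorems.LatticeGapInUVUnitsC.AmplitudeRatchet.stub_seed G r a Γ β₀ ℓ₀ c C ha hℓ₀ hc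
      hpos hlim hΓ hbox
  obtain ⟨κ, β₂, K, hκ, hcert⟩ := hCert G hG r umin humin
  exact concl_of_fsCertificate r hpos hlim hℓ₀ hκ hseed hcert

end Summit.QuantumFields.YangMills.Theorems.LatticeGapInUVUnitsC.AmplitudeCriterion

end
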